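import Literature.MathematicalPhysics.QuantumManyBody.BoseGasHardCoreCriticalDensity

/-!
# Cluster trial states: one particle per cube, with interaction

Topic `Literature/MathematicalPhysics/QuantumManyBody`, over the carriers of
`BoseEinsteinCondensation.lean` and `BoseGasThermodynamicLimitRuelle.lean` (`rawEnergy`,
`SupportedState`, `infEnergy`, the symmetrised product `SupportedState.merge` of two states on
disjoint regions, `crossInteraction`) and `BoseGasHardCoreCriticalDensity.lean` (`cubeAt`).

Ruelle's subadditivity (`infEnergy_union_le`) merges states on regions farther apart than the
range of the potential, so that the two groups do not interact. The free-volume argument for a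
GENERAL pair potential (sequel files) needs trial states of many particles in tiny cubes that are
close together and DO interact, softly: this file computes the energy of the symmetrised product
with the interaction between the two groups kept,

* `rawEnergy_merge_eq_add_cross` — `𝓔[Ψ₁ ⊛ Ψ₂] = 𝓔[Ψ₁] + 𝓔[Ψ₂] + ∫ (∑_{i ∈ 1, j ∈ 2} v(|xᵢ - xⱼ|)) |Ψ₁|²|Ψ₂|²`
  for states on disjoint regions (the symmetrisation is exact on disjoint supports; Tonelli over
  the two blocks for the cross term, `lintegral_blocks`),

and builds, by induction over the cubes, the **cluster state** of `n` bosons, one in each of the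
cubes `cubeAt (c m) s`, `m < n` (centres pairwise `≥ 2s` apart), from translates of one fixed
one-particle state of the cube of side `s`:

* `exists_infEnergy_clusterRegion_le` — there are `E₁, C < ∞` (depending on `v` and `s` only)
  with `E(n, ⋃_{m<n} cubes) ≤ n E₁ + C ∑_{m<n} ∑_{m'<m} ∫_{B(c_{m'} - c_m, 2s)} v(|w|) dw`
  for all `n` and all admissible centres: each particle costs its one-cube energy, each pair of
  cubes the sup-norm of the one-particle density times the integral of the potential over the
  relative positions the pair can have.

References: D. Ruelle, *Statistical Mechanics: Rigorous Results* (1969) [Ruelle1969], §3.5.11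
(product states in the subadditivity argument); E. H. Lieb, R. Seiringer, J. P. Solovej,
J. Yngvason, *The Mathematics of the Bose Gas and its Condensation* (2005) [LSSY2005], Ch. 2.
The estimates are elementary and tagged folklore.
-/

noncomputable section

open MeasureTheory Filter Topology Set Function Metric
open scoped ENNReal NNReal

namespace Literature.MathematicalPhysics.QuantumManyBody.BoseGas

/-! ### Tonelli over the two blocks and the energy of the product with interaction -/

section Cross

open scoped Classical

variable {N₁ N₂ : ℕ} {U₁ U₂ : Set Space}

/-- **Tonelli over the two blocks**: `∫ H(X₁, X₂) dX = ∫ (∫ H(Y, Z) dZ) dY` along the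
juxtaposition `(ℝ³)^{N₁} × (ℝ³)^{N₂} ≃ (ℝ³)^{N₁+N₂}`. [folklore] -/
theorem lintegral_blocks {H : Config N₁ → Config N₂ → ℝ≥0∞}
    (hH : Measurable fun p : Config N₁ × Config N₂ => H p.1 p.2) :
    (∫⁻ X : Config (N₁ + N₂), H (X ∘ Fin.castAdd N₂) (X ∘ Fin.natAdd N₁)) =
      ∫⁻ Y, ∫⁻ Z, H Y Z := by
  let e : (Config N₁ × Config N₂) ≃ᵐ Config (N₁ + N₂) :=
    (MeasurableEquiv.sumPiEquivProdPi fun _ : Fin N₁ ⊕ Fin N₂ => Space).symm.trans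
      (MeasurableEquiv.piCongrLeft (fun _ : Fin (N₁ + N₂) => Space) finSumFinEquiv)
  have he : MeasurePreserving e ((volume : Measure (Config N₁)).prod volume) volume :=
    (volume_measurePreserving_sumPiEquivProdPi_symm fun _ : Fin N₁ ⊕ Fin N₂ => Space).trans
      (volume_measurePreserving_piCongrLeft (fun _ : Fin (N₁ + N₂) => Space) finSumFinEquiv)
  have he1 : ∀ p : Config N₁ × Config N₂, (e p) ∘ Fin.castAdd N₂ = p.1 := by
    intro p
    funext i
    change (Equiv.piCongrLeft (fun _ => Space) finSumFinEquiv
      ((Equiv.sumPiEquivProdPi fun _ : Fin N₁ ⊕ Fin N₂ => Space).symm p)) (Fin.castAdd N₂ i) = _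
    rw [← finSumFinEquiv_apply_left, Equiv.piCongrLeft_apply_apply]
    rfl
  have he2 : ∀ p : Config N₁ × Config N₂, (e p) ∘ Fin.natAdd N₁ = p.2 := by
    intro p
    funext j
    change (Equiv.piCongrLeft (fun _ => Space) finSumFinEquiv
      ((Equiv.sumPiEquivProdPi fun _ : Fin N₁ ⊕ Fin N₂ => Space).symm p)) (Fin.natAdd N₁ j) = _
    rw [← finSumFinEquiv_apply_right, Equiv.piCongrLeft_apply_apply]
    rfl
  rw [he.lintegral_map_equiv]
  simp only [he1, he2]
  exact lintegral_prod _ hH.aemeasurable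

variable (Ψ₁ : SupportedState N₁ U₁) (Ψ₂ : SupportedState N₂ U₂) {v : ℝ → ℝ≥0∞}

/-- The cross term `∫ (∑_{i ∈ 1, j ∈ 2} v(|xᵢ - xⱼ|)) |Ψ₁(X₁)|² |Ψ₂(X₂)|² dX` of the product of two
states. [folklore] -/
def crossEnergy (v : ℝ → ℝ≥0∞) : ℝ≥0∞ :=
  ∫⁻ X : Config (N₁ + N₂), crossInteraction v X *
    ((‖Ψ₁.ψ (X ∘ Fin.castAdd N₂)‖₊ : ℝ≥0∞) ^ 2 * (‖Ψ₂.ψ (X ∘ Fin.natAdd N₁)‖₊ : ℝ≥0∞) ^ 2)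

/-- The cross interaction is measurable. [folklore] -/
theorem measurable_crossInteraction (hv : Measurable v) :
    Measurable (crossInteraction (N₁ := N₁) (N₂ := N₂) v) := by
  unfold crossInteraction
  refine Finset.measurable_sum _ fun i _ => Finset.measurable_sum _ fun j _ => ?_
  exact hv.comp (measurable_dist_pair _ _)

/-- **Energy of the product with interaction**:
`𝓔[Ψ₁ ⊗ Ψ₂] = 𝓔[Ψ₁] + 𝓔[Ψ₂] + cross`. [cite: Ruelle1969, §3.5.11] -/
theorem rawEnergy_prodFun_eq_add_cross (hv : Measurable v) :
    rawEnergy v (prodFun Ψ₁.ψ Ψ₂.ψ) =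
      rawEnergy v Ψ₁.ψ + rawEnergy v Ψ₂.ψ + crossEnergy Ψ₁ Ψ₂ v := by
  set F₁ : Config N₁ → ℝ≥0∞ := fun Y =>
    kineticDensity Ψ₁.ψ Y + interaction v Y * (‖Ψ₁.ψ Y‖₊ : ℝ≥0∞) ^ 2 with hF₁
  set F₂ : Config N₂ → ℝ≥0∞ := fun Y =>
    kineticDensity Ψ₂.ψ Y + interaction v Y * (‖Ψ₂.ψ Y‖₊ : ℝ≥0∞) ^ 2 with hF₂
  set G₁ : Config N₁ → ℝ≥0∞ := fun Y => (‖Ψ₁.ψ Y‖₊ : ℝ≥0∞) ^ 2 with hG₁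
  set G₂ : Config N₂ → ℝ≥0∞ := fun Y => (‖Ψ₂.ψ Y‖₊ : ℝ≥0∞) ^ 2 with hG₂
  have mF₁ : Measurable F₁ := measurable_energyDensity hv Ψ₁.contDiff.continuous
  have mF₂ : Measurable F₂ := measurable_energyDensity hv Ψ₂.contDiff.continuous
  have mG₁ : Measurable G₁ := measurable_ennnormSq Ψ₁.contDiff.continuous
  have mG₂ : Measurable G₂ := measurable_ennnormSq Ψ₂.contDiff.continuous
  have hpt : ∀ X : Config (N₁ + N₂), kineticDensity (prodFun Ψ₁.ψ Ψ₂.ψ) X +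
      interaction v X * (‖prodFun Ψ₁.ψ Ψ₂.ψ X‖₊ : ℝ≥0∞) ^ 2 =
      (F₁ (X ∘ Fin.castAdd N₂) * G₂ (X ∘ Fin.natAdd N₁) +
        G₁ (X ∘ Fin.castAdd N₂) * F₂ (X ∘ Fin.natAdd N₁)) +
        crossInteraction v X * (G₁ (X ∘ Fin.castAdd N₂) * G₂ (X ∘ Fin.natAdd N₁)) := by
    intro X
    rw [kineticDensity_prodFun_state, interaction_blocks, normSq_prodFun]
    simp only [hF₁, hF₂, hG₁, hG₂]
    ring
  have m1 : Measurable fun X : Config (N₁ + N₂) =>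
      F₁ (X ∘ Fin.castAdd N₂) * G₂ (X ∘ Fin.natAdd N₁) :=
    (mF₁.comp (precompCLM (Fin.castAdd N₂)).continuous.measurable).mul
      (mG₂.comp (precompCLM (Fin.natAdd N₁)).continuous.measurable)
  have m2 : Measurable fun X : Config (N₁ + N₂) =>
      G₁ (X ∘ Fin.castAdd N₂) * F₂ (X ∘ Fin.natAdd N₁) :=
    (mG₁.comp (precompCLM (Fin.castAdd N₂)).continuous.measurable).mul
      (mF₂.comp (precompCLM (Fin.natAdd N₁)).continuous.measurable)
  have m12 : Measurable fun X : Config (N₁ + N₂) =>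
      F₁ (X ∘ Fin.castAdd N₂) * G₂ (X ∘ Fin.natAdd N₁) +
        G₁ (X ∘ Fin.castAdd N₂) * F₂ (X ∘ Fin.natAdd N₁) := m1.add m2
  calc rawEnergy v (prodFun Ψ₁.ψ Ψ₂.ψ)
      = ∫⁻ X : Config (N₁ + N₂), (F₁ (X ∘ Fin.castAdd N₂) * G₂ (X ∘ Fin.natAdd N₁) +
          G₁ (X ∘ Fin.castAdd N₂) * F₂ (X ∘ Fin.natAdd N₁)) +
          crossInteraction v X * (G₁ (X ∘ Fin.castAdd N₂) * G₂ (X ∘ Fin.natAdd N₁)) :=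
        lintegral_congr hpt
    _ = ((∫⁻ Y, F₁ Y) * (∫⁻ Z, G₂ Z) + (∫⁻ Y, G₁ Y) * ∫⁻ Z, F₂ Z) + crossEnergy Ψ₁ Ψ₂ v := by
        rw [lintegral_add_left m12, lintegral_add_left m1, lintegral_blocks_mul mF₁ mG₂,
          lintegral_blocks_mul mG₁ mF₂]
        rfl
    _ = rawEnergy v Ψ₁.ψ + rawEnergy v Ψ₂.ψ + crossEnergy Ψ₁ Ψ₂ v := by
        rw [show (∫⁻ Z, G₂ Z) = 1 from Ψ₂.norm_eq, show (∫⁻ Y, G₁ Y) = 1 from Ψ₁.norm_eq,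
          mul_one, one_mul]
        rfl

/-- `⟨S, H S⟩ = K 𝓔[Ψ₁ ⊗ Ψ₂]` for the symmetrised product `S` of states on DISJOINT regions (no
separation by the range needed for this identity). [cite: Ruelle1969, §3.5.11] -/
theorem rawEnergy_symSum_eq (hdisj : Disjoint U₁ U₂) (hv : Measurable v) :
    rawEnergy v (symSum Ψ₁ Ψ₂) = mergeConst N₁ N₂ * rawEnergy v (prodFun Ψ₁.ψ Ψ₂.ψ) := by
  have hpt : ∀ X, kineticDensity (symSum Ψ₁ Ψ₂) X +
      interaction v X * (‖symSum Ψ₁ Ψ₂ X‖₊ : ℝ≥0∞) ^ 2 =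
      blockPermCard N₁ N₂ * ∑ σ, (kineticDensity (permProd Ψ₁ Ψ₂ σ) X +
        interaction v X * (‖permProd Ψ₁ Ψ₂ σ X‖₊ : ℝ≥0∞) ^ 2) := by
    intro X
    rw [kineticDensity_symSum Ψ₁ Ψ₂ hdisj, normSq_symSum Ψ₁ Ψ₂ hdisj, Finset.sum_add_distrib,
      mul_add, Finset.mul_sum, Finset.mul_sum, Finset.mul_sum, Finset.mul_sum]
    congr 1
    refine Finset.sum_congr rfl fun σ _ => ?_
    ring
  have h1 : ∀ σ : Equiv.Perm (Fin (N₁ + N₂)),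
      (∫⁻ X, kineticDensity (permProd Ψ₁ Ψ₂ σ) X +
        interaction v X * (‖permProd Ψ₁ Ψ₂ σ X‖₊ : ℝ≥0∞) ^ 2) =
      rawEnergy v (prodFun Ψ₁.ψ Ψ₂.ψ) := fun σ =>
    rawEnergy_comp_perm_aux v (differentiable_prodFun Ψ₁ Ψ₂) σ
  unfold rawEnergy at h1 ⊢
  simp_rw [hpt]
  rw [lintegral_const_mul' _ _ (ENNReal.natCast_ne_top _), lintegral_finsetSum _ fun σ _ =>
    measurable_energyDensity hv (continuous_permProd Ψ₁ Ψ₂ σ)]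
  simp_rw [h1]
  rw [Finset.sum_const, Finset.card_univ, nsmul_eq_mul, ← mul_assoc]
  rfl

/-- **Energy of the merged state with interaction**:
`𝓔[Ψ₁ ⊛ Ψ₂] = 𝓔[Ψ₁] + 𝓔[Ψ₂] + cross` for states on disjoint regions. [cite: Ruelle1969, §3.5.11] -/
theorem rawEnergy_merge_eq_add_cross (hdisj : Disjoint U₁ U₂) (hv : Measurable v) :
    rawEnergy v (Ψ₁.merge Ψ₂ hdisj).ψ =
      rawEnergy v Ψ₁.ψ + rawEnergy v Ψ₂.ψ + crossEnergy Ψ₁ Ψ₂ v := by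
  have hpt : ∀ X, kineticDensity (Ψ₁.merge Ψ₂ hdisj).ψ X +
      interaction v X * (‖(Ψ₁.merge Ψ₂ hdisj).ψ X‖₊ : ℝ≥0∞) ^ 2 =
      (mergeScale N₁ N₂ : ℝ≥0∞) ^ 2 * (kineticDensity (symSum Ψ₁ Ψ₂) X +
        interaction v X * (‖symSum Ψ₁ Ψ₂ X‖₊ : ℝ≥0∞) ^ 2) := by
    intro X
    have hd := (hasFDerivAt_symSum Ψ₁ Ψ₂ X).const_mul ((mergeScale N₁ N₂ : ℝ) : ℂ)
    rw [kineticDensity_eq_gradSqCLM, kineticDensity_eq_gradSqCLM,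
      (hasFDerivAt_symSum Ψ₁ Ψ₂ X).fderiv]
    change gradSqCLM (fderiv ℝ (fun Y => ((mergeScale N₁ N₂ : ℝ) : ℂ) * symSum Ψ₁ Ψ₂ Y) X) +
      interaction v X * (‖((mergeScale N₁ N₂ : ℝ) : ℂ) * symSum Ψ₁ Ψ₂ X‖₊ : ℝ≥0∞) ^ 2 = _
    rw [hd.fderiv, gradSqCLM_smul, ennnorm_mul_sq, ennnorm_mergeScale_sq]
    ring
  calc rawEnergy v (Ψ₁.merge Ψ₂ hdisj).ψ
      = (mergeScale N₁ N₂ : ℝ≥0∞) ^ 2 * rawEnergy v (symSum Ψ₁ Ψ₂) := by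
        unfold rawEnergy
        rw [← lintegral_const_mul' _ _ (by simp)]
        exact lintegral_congr hpt
    _ = rawEnergy v Ψ₁.ψ + rawEnergy v Ψ₂.ψ + crossEnergy Ψ₁ Ψ₂ v := by
        rw [rawEnergy_symSum_eq Ψ₁ Ψ₂ hdisj hv, ← mul_assoc, mergeScale_sq_mul, one_mul,
          rawEnergy_prodFun_eq_add_cross Ψ₁ Ψ₂ hv]

/-- The merged state does not vanish only where some relabelling puts the first block in the
support of `Ψ₁` and the second in the support of `Ψ₂`. [folklore] -/
theorem exists_perm_of_merge_ne_zero (hdisj : Disjoint U₁ U₂) {X : Config (N₁ + N₂)}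
    (hX : (Ψ₁.merge Ψ₂ hdisj).ψ X ≠ 0) :
    ∃ σ : Equiv.Perm (Fin (N₁ + N₂)),
      Ψ₁.ψ ((X ∘ σ) ∘ Fin.castAdd N₂) ≠ 0 ∧ Ψ₂.ψ ((X ∘ σ) ∘ Fin.natAdd N₁) ≠ 0 := by
  have h : symSum Ψ₁ Ψ₂ X ≠ 0 := by
    intro h0
    apply hX
    change ((mergeScale N₁ N₂ : ℝ) : ℂ) * symSum Ψ₁ Ψ₂ X = 0
    rw [h0, mul_zero]
  obtain ⟨σ, -, hσ⟩ := Finset.exists_ne_zero_of_sum_ne_zero h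
  rw [permProd, prodFun_eq] at hσ
  exact ⟨σ, left_ne_zero_of_mul hσ, right_ne_zero_of_mul hσ⟩

end Cross

/-! ### The cross term against a single particle -/

section Single

open scoped Classical

variable {n : ℕ} {U Q : Set Space} (Ψ : SupportedState n U) (Φ : SupportedState 1 Q)
  {v : ℝ → ℝ≥0∞}

/-- The potential created at `y` by the one-particle state `Φ`: `W(y) = ∫ v(|y - z|) |Φ(z)|² dz`.
[folklore] -/
def smearedPotential (v : ℝ → ℝ≥0∞) (Φ : SupportedState 1 Q) (y : Space) : ℝ≥0∞ :=
  ∫⁻ Z : Config 1, v (dist y (Z 0)) * (‖Φ.ψ Z‖₊ : ℝ≥0∞) ^ 2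

/-- Joint measurability of `(y, Z) ↦ v(|y - z₀|) |Φ(Z)|²`. [folklore] -/
theorem measurable_smear_integrand (hv : Measurable v) :
    Measurable fun p : Space × Config 1 => v (dist p.1 (p.2 0)) * (‖Φ.ψ p.2‖₊ : ℝ≥0∞) ^ 2 :=
  (hv.comp (measurable_fst.dist ((measurable_pi_apply 0).comp measurable_snd))).mul
    ((measurable_ennnormSq Φ.contDiff.continuous).comp measurable_snd)

/-- The smeared potential is measurable. [folklore] -/
theorem measurable_smearedPotential (hv : Measurable v) : Measurable (smearedPotential v Φ) :=
  (measurable_smear_integrand Φ hv).lintegral_prod_right'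

/-- **The cross term against one particle**: for a second block consisting of a single particle,
`cross = ∫ |Ψ(Y)|² ∑ᵢ W(yᵢ) dY`. [folklore] -/
theorem crossEnergy_one_eq (hv : Measurable v) :
    crossEnergy Ψ Φ v = ∫⁻ Y, (‖Ψ.ψ Y‖₊ : ℝ≥0∞) ^ 2 * ∑ i, smearedPotential v Φ (Y i) := by
  -- the summands of the cross term
  set T : Fin n → Config (n + 1) → ℝ≥0∞ := fun i X =>
    (‖Ψ.ψ (X ∘ Fin.castAdd 1)‖₊ : ℝ≥0∞) ^ 2 *
      (v (dist ((X ∘ Fin.castAdd 1) i) ((X ∘ Fin.natAdd n) 0)) *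
        (‖Φ.ψ (X ∘ Fin.natAdd n)‖₊ : ℝ≥0∞) ^ 2) with hT
  have hsum : ∀ X : Config (n + 1), crossInteraction v X *
      ((‖Ψ.ψ (X ∘ Fin.castAdd 1)‖₊ : ℝ≥0∞) ^ 2 * (‖Φ.ψ (X ∘ Fin.natAdd n)‖₊ : ℝ≥0∞) ^ 2) =
      ∑ i, T i X := by
    intro X
    rw [crossInteraction, Finset.sum_mul]
    refine Finset.sum_congr rfl fun i _ => ?_
    rw [Fin.sum_univ_one, hT]
    simp only [Function.comp_apply]
    ring
  -- joint measurability of the two-block integrand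
  have hH : ∀ i : Fin n, Measurable fun p : Config n × Config 1 =>
      (‖Ψ.ψ p.1‖₊ : ℝ≥0∞) ^ 2 * (v (dist (p.1 i) (p.2 0)) * (‖Φ.ψ p.2‖₊ : ℝ≥0∞) ^ 2) := by
    intro i
    have hA : Measurable fun p : Config n × Config 1 => (‖Ψ.ψ p.1‖₊ : ℝ≥0∞) ^ 2 :=
      (measurable_ennnormSq Ψ.contDiff.continuous).comp measurable_fst
    have hB : Measurable fun p : Config n × Config 1 => v (dist (p.1 i) (p.2 0)) :=
      hv.comp (((measurable_pi_apply i).comp measurable_fst).dist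
        ((measurable_pi_apply 0).comp measurable_snd))
    have hC : Measurable fun p : Config n × Config 1 => (‖Φ.ψ p.2‖₊ : ℝ≥0∞) ^ 2 :=
      (measurable_ennnormSq Φ.contDiff.continuous).comp measurable_snd
    exact hA.mul (hB.mul hC)
  have hTm : ∀ i, Measurable (T i) := by
    intro i
    have hA : Measurable fun X : Config (n + 1) => (‖Ψ.ψ (X ∘ Fin.castAdd 1)‖₊ : ℝ≥0∞) ^ 2 :=
      (measurable_ennnormSq Ψ.contDiff.continuous).comp
        (precompCLM (Fin.castAdd (n := n) 1)).continuous.measurable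
    have hB : Measurable fun X : Config (n + 1) =>
        v (dist ((X ∘ Fin.castAdd 1) i) ((X ∘ Fin.natAdd n) 0)) :=
      hv.comp (measurable_dist_pair (Fin.castAdd 1 i) (Fin.natAdd n 0))
    have hC : Measurable fun X : Config (n + 1) => (‖Φ.ψ (X ∘ Fin.natAdd n)‖₊ : ℝ≥0∞) ^ 2 :=
      (measurable_ennnormSq Φ.contDiff.continuous).comp
        (precompCLM (Fin.natAdd n (m := 1))).continuous.measurable
    exact hA.mul (hB.mul hC)
  have hTint : ∀ i, ∫⁻ X, T i X = ∫⁻ Y, (‖Ψ.ψ Y‖₊ : ℝ≥0∞) ^ 2 * smearedPotential v Φ (Y i) := by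
    intro i
    have h := lintegral_blocks (H := fun Y Z => (‖Ψ.ψ Y‖₊ : ℝ≥0∞) ^ 2 *
      (v (dist (Y i) (Z 0)) * (‖Φ.ψ Z‖₊ : ℝ≥0∞) ^ 2)) (hH i)
    refine h.trans (lintegral_congr fun Y => ?_)
    have hm : Measurable fun Z : Config 1 => v (dist (Y i) (Z 0)) * (‖Φ.ψ Z‖₊ : ℝ≥0∞) ^ 2 :=
      (hv.comp (measurable_const.dist (measurable_pi_apply 0))).mul
        (measurable_ennnormSq Φ.contDiff.continuous)
    exact lintegral_const_mul _ hm
  have hWm : ∀ i : Fin n, Measurable fun Y : Config n =>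
      (‖Ψ.ψ Y‖₊ : ℝ≥0∞) ^ 2 * smearedPotential v Φ (Y i) := fun i =>
    (measurable_ennnormSq Ψ.contDiff.continuous).mul
      ((measurable_smearedPotential Φ hv).comp (measurable_pi_apply i))
  unfold crossEnergy
  simp_rw [hsum]
  rw [lintegral_finsetSum Finset.univ fun i _ => hTm i]
  simp_rw [hTint]
  rw [← lintegral_finsetSum Finset.univ fun i _ => hWm i]
  refine lintegral_congr fun Y => ?_
  rw [Finset.mul_sum]

/-- `∫ g(z₀) dZ = ∫ g(z) dz` over one-particle configurations. [folklore] -/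
theorem lintegral_funUnique_comp (g : Space → ℝ≥0∞) :
    ∫⁻ Z : Config 1, g (Z 0) = ∫⁻ z, g z :=
  (volume_preserving_funUnique (Fin 1) Space).lintegral_comp_emb
    (MeasurableEquiv.measurableEmbedding _) g

/-- **Bound on the smeared potential of a bounded state in `Q`**:
`W(y) ≤ sup|Φ|² · ∫_Q v(|y - z|) dz`. [folklore] -/
theorem smearedPotential_le {C : ℝ≥0∞} (hC : ∀ Z, (‖Φ.ψ Z‖₊ : ℝ≥0∞) ^ 2 ≤ C) (hv : Measurable v)
    (hQ : MeasurableSet Q) (y : Space) : smearedPotential v Φ y ≤ C * ∫⁻ z in Q, v (dist y z) := by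
  unfold smearedPotential
  have hpt : ∀ Z : Config 1, v (dist y (Z 0)) * (‖Φ.ψ Z‖₊ : ℝ≥0∞) ^ 2 ≤
      C * Q.indicator (fun z => v (dist y z)) (Z 0) := by
    intro Z
    by_cases hZ : Z 0 ∈ Q
    · rw [indicator_of_mem hZ, mul_comm]
      exact mul_le_mul' (hC Z) le_rfl
    · have h0 : Φ.ψ Z = 0 := Φ.eq_zero Z ⟨0, hZ⟩
      simp [h0]
  refine (lintegral_mono hpt).trans (le_of_eq ?_)
  have hm : Measurable fun z : Space => Q.indicator (fun z => v (dist y z)) z :=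
    (hv.comp (measurable_const.dist measurable_id)).indicator hQ
  have hm' : Measurable fun Z : Config 1 => Q.indicator (fun z => v (dist y z)) (Z 0) :=
    hm.comp (measurable_pi_apply 0)
  rw [lintegral_const_mul _ hm', ← lintegral_indicator hQ]
  congr 1
  exact lintegral_funUnique_comp _

/-- Translating the ball: `∫_{B(c,η)} v(|z - p|) dz = ∫_{B(c - p, η)} v(|w|) dw`. [folklore] -/
theorem setLIntegral_ball_norm_sub (v : ℝ → ℝ≥0∞) (c p : Space) (η : ℝ) :
    ∫⁻ z in ball c η, v ‖z - p‖ = ∫⁻ w in ball (c - p) η, v ‖w‖ := by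
  rw [← lintegral_indicator measurableSet_ball, ← lintegral_indicator measurableSet_ball]
  have h : ∀ z : Space, (ball c η).indicator (fun z => v ‖z - p‖) z =
      (ball (c - p) η).indicator (fun w => v ‖w‖) (z - p) := by
    intro z
    have hmem : z ∈ ball c η ↔ z - p ∈ ball (c - p) η := by
      rw [mem_ball, mem_ball, dist_eq_norm, dist_eq_norm, sub_sub_sub_cancel_right]
    by_cases hz : z ∈ ball c η
    · rw [indicator_of_mem hz, indicator_of_mem (hmem.1 hz)]
    · rw [indicator_of_notMem hz, indicator_of_notMem (fun h' => hz (hmem.2 h'))]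
  simp_rw [h]
  exact lintegral_sub_right_eq_self (fun w => (ball (c - p) η).indicator (fun w => v ‖w‖) w) p

/-- **The pair bound.** For `y` within `s` of `c'`, the integral of `v(|y - z|)` over the cube of
side `s` centred at `c` is at most `∫_{B(c - c', 2s)} v(|w|) dw`. [folklore] -/
theorem setLIntegral_cubeAt_le_ball {s : ℝ} (hs : 0 < s) {c c' y : Space} (hy : dist y c' < s) :
    ∫⁻ z in cubeAt c s, v (dist y z) ≤ ∫⁻ w in ball (c - c') (2 * s), v ‖w‖ := by
  calc ∫⁻ z in cubeAt c s, v (dist y z) ≤ ∫⁻ z in ball c s, v (dist y z) :=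
        lintegral_mono_set fun z hz => mem_ball.2 (dist_lt_of_mem_cubeAt hs hz)
    _ = ∫⁻ z in ball c s, v ‖z - y‖ := by simp_rw [dist_comm y, dist_eq_norm]
    _ = ∫⁻ w in ball (c - y) s, v ‖w‖ := setLIntegral_ball_norm_sub v c y s
    _ ≤ ∫⁻ w in ball (c - c') (2 * s), v ‖w‖ := by
        refine lintegral_mono_set (ball_subset_ball' ?_)
        rw [dist_eq_norm, sub_sub_sub_cancel_left, ← dist_eq_norm, dist_comm]
        linarith

end Single

/-! ### A bounded one-particle state of the cube -/

section Bump

variable {s : ℝ}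

/-- The interaction of a single particle vanishes. [folklore] -/
theorem interaction_one (v : ℝ → ℝ≥0∞) (X : Config 1) : interaction v X = 0 := by
  refine Finset.sum_eq_zero fun i _ => Finset.sum_eq_zero fun j hj => ?_
  have := (Finset.mem_filter.1 hj).2
  exact absurd this (by rw [Subsingleton.elim i j]; exact lt_irrefl _)

/-- **A bounded one-particle trial state of the cube `Λ_s` with finite energy** (a normalised
`C¹` bump): its energy is kinetic only, hence finite and independent of the potential, and its
density is bounded. [folklore] -/
theorem exists_bumpState (hs : 0 < s) :
    ∃ (Φ : TrialState 1 s) (C : ℝ≥0), (∀ v : ℝ → ℝ≥0∞, rawEnergy v Φ.ψ < ⊤) ∧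
      ∀ X, (‖Φ.ψ X‖₊ : ℝ≥0∞) ^ 2 ≤ C := by
  obtain ⟨φ, hφc, hφs, hφbox, hφ1, C, hφC⟩ := exists_normalised_bump hs
  let ψ : Config 1 → ℂ := fun X => φ (X 0)
  have hψc : ContDiff ℝ 1 ψ :=
    hφc.comp (ContinuousLinearMap.proj (R := ℝ) (φ := fun _ : Fin 1 => Space) 0).contDiff
  have hψs : HasCompactSupport ψ := by
    refine HasCompactSupport.intro (isCompact_univ_pi fun _ : Fin 1 => hφs) fun X hX => ?_
    simp only [Set.mem_univ_pi, not_forall] at hX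
    obtain ⟨i, hi⟩ := hX
    rw [Subsingleton.elim i 0] at hi
    change φ (X 0) = 0
    exact image_eq_zero_of_notMem_tsupport hi
  have hgm : Measurable fun x : Space => (‖φ x‖₊ : ℝ≥0∞) ^ 2 :=
    (hφc.continuous.measurable.nnnorm.coe_nnreal_ennreal).pow_const 2
  let Φ : TrialState 1 s :=
    { ψ := ψ
      contDiff := hψc
      eq_zero := fun X hX => by
        simp only [boxN, Set.mem_setOf_eq, not_forall] at hX
        obtain ⟨i, hi⟩ := hX
        rw [Subsingleton.elim i 0] at hi
        by_contra h
        exact hi (hφbox _ h)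
      symm := fun σ X => by
        change φ ((X ∘ σ) 0) = φ (X 0)
        rw [Subsingleton.elim σ 1]
        rfl
      norm_eq := by
        change (∫⁻ X : Config 1, (‖φ (X 0)‖₊ : ℝ≥0∞) ^ 2) = 1
        rw [lintegral_funUnique_comp (fun x => (‖φ x‖₊ : ℝ≥0∞) ^ 2), hφ1] }
  refine ⟨Φ, C, fun v => ?_, fun X => hφC (X 0)⟩
  -- finite kinetic energy: `∇ψ` is continuous with compact support
  have hkin : ∀ (i : Fin 1) (k : Fin 3),
      (∫⁻ X, (‖fderiv ℝ ψ X (unitVec i k)‖₊ : ℝ≥0∞) ^ 2) < ⊤ := by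
    intro i k
    have hg : Continuous fun X => fderiv ℝ ψ X (unitVec i k) :=
      (hψc.continuous_fderiv one_ne_zero).clm_apply continuous_const
    have hgs : HasCompactSupport fun X => fderiv ℝ ψ X (unitVec i k) :=
      hψs.fderiv_apply (𝕜 := ℝ) _
    have hgs2 : HasCompactSupport fun X => ‖fderiv ℝ ψ X (unitVec i k)‖ ^ 2 :=
      hgs.mono fun X hX h0 => hX (by simp [h0])
    have hint2 : Integrable (fun X => ‖fderiv ℝ ψ X (unitVec i k)‖ ^ 2) volume :=
      (hg.norm.pow 2).integrable_of_hasCompactSupport hgs2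
    have := hint2.lintegral_lt_top
    refine lt_of_le_of_lt (le_of_eq (lintegral_congr fun X => ?_)) this
    rw [ENNReal.ofReal_pow (norm_nonneg _), ofReal_norm]
    rfl
  change (∫⁻ X, kineticDensity ψ X + interaction v X * (‖ψ X‖₊ : ℝ≥0∞) ^ 2) < ⊤
  simp_rw [interaction_one, zero_mul, add_zero, kineticDensity]
  rw [lintegral_finsetSum _ fun i _ => Finset.measurable_sum _ fun j _ =>
    ((measurable_fderiv_apply_const ℝ ψ _).nnnorm.coe_nnreal_ennreal).pow_const 2]
  refine ENNReal.sum_lt_top.2 fun i _ => ?_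
  rw [lintegral_finsetSum _ fun j _ =>
    ((measurable_fderiv_apply_const ℝ ψ _).nnnorm.coe_nnreal_ennreal).pow_const 2]
  exact ENNReal.sum_lt_top.2 fun j _ => hkin i j

/-- A fixed bounded one-particle trial state of `Λ_s` with finite energy. [folklore] -/
def bumpState (hs : 0 < s) : TrialState 1 s := (exists_bumpState hs).choose

/-- Its density bound. [folklore] -/
def bumpBound (hs : 0 < s) : ℝ≥0 := (exists_bumpState hs).choose_spec.choose

/-- The energy of the bump state is finite. [folklore] -/
theorem rawEnergy_bumpState_lt_top (hs : 0 < s) (v : ℝ → ℝ≥0∞) :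
    rawEnergy v (bumpState hs).ψ < ⊤ :=
  (exists_bumpState hs).choose_spec.choose_spec.1 v

/-- The density of the bump state is bounded by `bumpBound`. [folklore] -/
theorem normSq_bumpState_le (hs : 0 < s) (X : Config 1) :
    (‖(bumpState hs).ψ X‖₊ : ℝ≥0∞) ^ 2 ≤ bumpBound hs :=
  (exists_bumpState hs).choose_spec.choose_spec.2 X

/-- The bump state placed in the cube of side `s` centred at `y`. [folklore] -/
def bumpAt (hs : 0 < s) (y : Space) : SupportedState 1 (cubeAt y s) :=
  (bumpState hs).toSupported.translate (y - WithLp.toLp 2 fun _ => s / 2)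

/-- The translated bump has the energy of the bump. [folklore] -/
theorem rawEnergy_bumpAt (hs : 0 < s) (y : Space) (v : ℝ → ℝ≥0∞) :
    rawEnergy v (bumpAt hs y).ψ = rawEnergy v (bumpState hs).ψ :=
  rawEnergy_translate v _ _

/-- The translated bump obeys the same density bound. [folklore] -/
theorem normSq_bumpAt_le (hs : 0 < s) (y : Space) (X : Config 1) :
    (‖(bumpAt hs y).ψ X‖₊ : ℝ≥0∞) ^ 2 ≤ bumpBound hs :=
  normSq_bumpState_le hs _

/-- A supported state does not vanish only with all particles in its region. [folklore] -/
theorem SupportedState.mem_of_ne_zero {N : ℕ} {U : Set Space} (Ψ : SupportedState N U)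
    {X : Config N} (hX : Ψ.ψ X ≠ 0) (i : Fin N) : X i ∈ U := by
  by_contra h
  exact hX (Ψ.eq_zero X ⟨i, h⟩)

/-- The centred cube is measurable. [folklore] -/
theorem measurableSet_cubeAt (y : Space) (s : ℝ) : MeasurableSet (cubeAt y s) :=
  (measurableSet_box s).preimage (measurable_id.sub measurable_const)

end Bump

/-! ### The cluster state: one particle in each cube -/

section Cluster

variable {v : ℝ → ℝ≥0∞} {s : ℝ} {c : ℕ → Space}

/-- The union of the first `n` cubes `cubeAt (c m) s`, `m < n`. [folklore] -/
def clusterRegion (c : ℕ → Space) (s : ℝ) (n : ℕ) : Set Space :=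
  ⋃ m ∈ Finset.range n, cubeAt (c m) s

/-- Cubes of side `s` with centres `≥ 2s` apart (those of index `< K`): the next cube is
disjoint from the previous ones. [folklore] -/
theorem disjoint_clusterRegion_cubeAt (hs : 0 < s) {K : ℕ}
    (hsep : ∀ m m', m < m' → m' < K → 2 * s ≤ dist (c m) (c m')) {n : ℕ} (hn : n < K) :
    Disjoint (clusterRegion c s n) (cubeAt (c n) s) := by
  rw [Set.disjoint_left]
  intro x hx hxn
  simp only [clusterRegion, Set.mem_iUnion, Finset.mem_range, exists_prop] at hx
  obtain ⟨m, hm, hxm⟩ := hx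
  have h1 := dist_lt_of_mem_cubeAt hs hxm
  have h2 := dist_lt_of_mem_cubeAt hs hxn
  have h3 := hsep m n hm hn
  have h4 : dist (c m) (c n) ≤ dist x (c m) + dist x (c n) := by
    rw [dist_comm x (c m)]; exact dist_triangle _ _ _
  linarith

/-- `clusterRegion (n+1) ⊇ clusterRegion n ∪ cube n`. [folklore] -/
theorem clusterRegion_union_subset (n : ℕ) :
    clusterRegion c s n ∪ cubeAt (c n) s ⊆ clusterRegion c s (n + 1) := by
  intro x hx
  simp only [clusterRegion, Set.mem_iUnion, Finset.mem_range, exists_prop, Set.mem_union] at hx ⊢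
  rcases hx with ⟨m, hm, hxm⟩ | hx
  · exact ⟨m, by omega, hxm⟩
  · exact ⟨n, by omega, hx⟩

/-- **The cluster state**: `n` bosons, one in each of the cubes `cubeAt (c m) s`, `m < n`, as the
iterated symmetrised product of translated bumps. [cite: Ruelle1969, §3.5.11] -/
def clusterState (hs : 0 < s) {K : ℕ}
    (hsep : ∀ m m', m < m' → m' < K → 2 * s ≤ dist (c m) (c m')) :
    (n : ℕ) → n ≤ K → SupportedState n (clusterRegion c s n)
  | 0, _ => SupportedState.vacuum _
  | n + 1, hn => (((clusterState hs hsep n (Nat.le_of_succ_le hn)).merge (bumpAt hs (c n))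
      (disjoint_clusterRegion_cubeAt hs hsep hn)).mono (clusterRegion_union_subset n))

/-- **Support of the cluster state**: where it does not vanish, the particles sit in distinct
cubes. [folklore] -/
theorem exists_injective_of_clusterState_ne_zero (hs : 0 < s) {K : ℕ}
    (hsep : ∀ m m', m < m' → m' < K → 2 * s ≤ dist (c m) (c m')) :
    ∀ (n : ℕ) (hn : n ≤ K) (X : Config n), (clusterState hs hsep n hn).ψ X ≠ 0 →
      ∃ g : Fin n → ℕ, Injective g ∧ ∀ k, g k < n ∧ X k ∈ cubeAt (c (g k)) s
  | 0, _, X, _ => ⟨Fin.elim0, fun i => i.elim0, fun i => i.elim0⟩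
  | n + 1, hn, X, hX => by
    obtain ⟨σ, h1, h2⟩ := exists_perm_of_merge_ne_zero (clusterState hs hsep n
      (Nat.le_of_succ_le hn)) (bumpAt hs (c n)) (disjoint_clusterRegion_cubeAt hs hsep hn) hX
    obtain ⟨g, hg, hgk⟩ := exists_injective_of_clusterState_ne_zero hs hsep n _ _ h1
    have hmem : X (σ (Fin.natAdd n 0)) ∈ cubeAt (c n) s :=
      (bumpAt hs (c n)).mem_of_ne_zero h2 0
    -- the assignment of cubes to the particles of `X`
    let g₀ : Fin (n + 1) → ℕ := fun j => Fin.addCases (motive := fun _ => ℕ) g (fun _ => n) j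
    refine ⟨fun k => g₀ (σ.symm k), ?_, ?_⟩
    · intro k₁ k₂ hk
      have key : ∀ j₁ j₂ : Fin (n + 1), g₀ j₁ = g₀ j₂ → j₁ = j₂ := by
        intro j₁ j₂
        induction j₁ using Fin.addCases with
        | left i₁ =>
          induction j₂ using Fin.addCases with
          | left i₂ =>
            intro h
            simp only [g₀, Fin.addCases_left] at h
            rw [hg h]
          | right l₂ =>
            intro h
            simp only [g₀, Fin.addCases_left, Fin.addCases_right] at h
            exact absurd h (hgk i₁).1.ne
        | right l₁ =>
          induction j₂ using Fin.addCases with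
          | left i₂ =>
            intro h
            simp only [g₀, Fin.addCases_left, Fin.addCases_right] at h
            exact absurd h.symm (hgk i₂).1.ne
          | right l₂ =>
            intro _
            rw [Subsingleton.elim l₁ l₂]
      exact σ.symm.injective (key _ _ hk)
    · intro k
      obtain ⟨j, rfl⟩ : ∃ j, k = σ j := ⟨σ.symm k, (σ.apply_symm_apply k).symm⟩
      simp only [Equiv.symm_apply_apply]
      induction j using Fin.addCases with
      | left i =>
        simp only [g₀, Fin.addCases_left]
        exact ⟨(hgk i).1.trans (Nat.lt_succ_self n), (hgk i).2⟩
      | right l =>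
        simp only [g₀, Fin.addCases_right]
        rw [Subsingleton.elim l 0]
        exact ⟨Nat.lt_succ_self n, hmem⟩

/-- The pair term between the cubes `m'` (earlier) and `m`: the integral of the potential over
the ball of radius `2s` around the relative position of the centres. [folklore] -/
def pairBall (v : ℝ → ℝ≥0∞) (c : ℕ → Space) (s : ℝ) (m' m : ℕ) : ℝ≥0∞ :=
  ∫⁻ w in ball (c m - c m') (2 * s), v ‖w‖

/-- **Energy of the cluster state**: each particle costs the bump energy, each pair of cubes at
most `sup|bump|² ·` the pair term. [cite: Ruelle1969, §3.5.11] -/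
theorem rawEnergy_clusterState_le (hv : Measurable v) (hs : 0 < s) {K : ℕ}
    (hsep : ∀ m m', m < m' → m' < K → 2 * s ≤ dist (c m) (c m')) :
    ∀ (n : ℕ) (hn : n ≤ K), rawEnergy v (clusterState hs hsep n hn).ψ ≤
      ∑ m ∈ Finset.range n, (rawEnergy v (bumpState hs).ψ +
        bumpBound hs * ∑ m' ∈ Finset.range m, pairBall v c s m' m)
  | 0, _ => by
    refine le_of_eq ?_
    rw [Finset.range_zero, Finset.sum_empty]
    refine (lintegral_congr fun X => ?_).trans lintegral_zero
    simp [kineticDensity, interaction, clusterState, SupportedState.vacuum]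
  | n + 1, hn => by
    have ih := rawEnergy_clusterState_le hv hs hsep n (Nat.le_of_succ_le hn)
    set Ψ := clusterState hs hsep n (Nat.le_of_succ_le hn) with hΨ
    set Φ := bumpAt hs (c n) with hΦ
    have hdisj := disjoint_clusterRegion_cubeAt hs hsep hn
    -- the cross term
    have hcross : crossEnergy Ψ Φ v ≤ bumpBound hs * ∑ m' ∈ Finset.range n, pairBall v c s m' n := by
      rw [crossEnergy_one_eq Ψ Φ hv]
      set B : ℝ≥0∞ := bumpBound hs * ∑ m' ∈ Finset.range n, pairBall v c s m' n with hB
      have hpt : ∀ Y, (‖Ψ.ψ Y‖₊ : ℝ≥0∞) ^ 2 * ∑ i, smearedPotential v Φ (Y i) ≤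
          (‖Ψ.ψ Y‖₊ : ℝ≥0∞) ^ 2 * B := by
        intro Y
        by_cases hY : Ψ.ψ Y = 0
        · simp [hY]
        · refine mul_le_mul' le_rfl ?_
          obtain ⟨g, hg, hgk⟩ := exists_injective_of_clusterState_ne_zero hs hsep n _ Y hY
          have hW : ∀ i, smearedPotential v Φ (Y i) ≤ bumpBound hs * pairBall v c s (g i) n := by
            intro i
            refine (smearedPotential_le Φ (normSq_bumpAt_le hs (c n)) hv
              (measurableSet_cubeAt _ _) (Y i)).trans (mul_le_mul' le_rfl ?_)
            exact setLIntegral_cubeAt_le_ball hs (dist_lt_of_mem_cubeAt hs (hgk i).2)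
          calc ∑ i, smearedPotential v Φ (Y i) ≤ ∑ i, bumpBound hs * pairBall v c s (g i) n :=
                Finset.sum_le_sum fun i _ => hW i
            _ = bumpBound hs * ∑ i, pairBall v c s (g i) n := by rw [Finset.mul_sum]
            _ = bumpBound hs * ∑ m' ∈ Finset.univ.image g, pairBall v c s m' n := by
                rw [Finset.sum_image fun i _ j _ h => hg h]
            _ ≤ B := by
                refine mul_le_mul' le_rfl (Finset.sum_le_sum_of_subset_of_nonneg ?_
                  fun _ _ _ => zero_le)
                intro m' hm'
                simp only [Finset.mem_image, Finset.mem_univ, true_and] at hm'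
                obtain ⟨i, rfl⟩ := hm'
                exact Finset.mem_range.2 (hgk i).1
      calc ∫⁻ Y, (‖Ψ.ψ Y‖₊ : ℝ≥0∞) ^ 2 * ∑ i, smearedPotential v Φ (Y i)
          ≤ ∫⁻ Y, (‖Ψ.ψ Y‖₊ : ℝ≥0∞) ^ 2 * B := lintegral_mono hpt
        _ = B := by
            rw [lintegral_mul_const _ (measurable_ennnormSq Ψ.contDiff.continuous), Ψ.norm_eq,
              one_mul]
    -- assemble
    calc rawEnergy v (clusterState hs hsep (n + 1) hn).ψ
        = rawEnergy v (Ψ.merge Φ hdisj).ψ := rfl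
      _ = rawEnergy v Ψ.ψ + rawEnergy v Φ.ψ + crossEnergy Ψ Φ v :=
          rawEnergy_merge_eq_add_cross Ψ Φ hdisj hv
      _ ≤ (∑ m ∈ Finset.range n, (rawEnergy v (bumpState hs).ψ +
            bumpBound hs * ∑ m' ∈ Finset.range m, pairBall v c s m' m)) +
            rawEnergy v (bumpState hs).ψ +
            bumpBound hs * ∑ m' ∈ Finset.range n, pairBall v c s m' n := by
          refine add_le_add (add_le_add ih (le_of_eq (rawEnergy_bumpAt hs (c n) v))) hcross
      _ = ∑ m ∈ Finset.range (n + 1), (rawEnergy v (bumpState hs).ψ +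
            bumpBound hs * ∑ m' ∈ Finset.range m, pairBall v c s m' m) := by
          rw [Finset.sum_range_succ, add_assoc]

/-- **Energy bound for `n` bosons in `n` cubes with interaction.** For every `s > 0` there are
`E₁, C < ∞` (depending on the potential and `s` only) such that for all `n` and all centres
`c₀, …, c_{n-1}` pairwise `≥ 2s` apart,
`E(n, ⋃_{m<n} cubeAt (c m) s) ≤ n E₁ + C ∑_{m<n} ∑_{m'<m} ∫_{B(c_m - c_{m'}, 2s)} v(|w|) dw`.
[cite: Ruelle1969, §3.5.11] -/
theorem exists_infEnergy_clusterRegion_le (hv : Measurable v) (hs : 0 < s) :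
    ∃ E₁ C : ℝ≥0∞, E₁ < ⊤ ∧ C < ⊤ ∧ ∀ (n : ℕ) (c : ℕ → Space),
      (∀ m m', m < m' → m' < n → 2 * s ≤ dist (c m) (c m')) →
        infEnergy v n (clusterRegion c s n) ≤
          n * E₁ + C * ∑ m ∈ Finset.range n, ∑ m' ∈ Finset.range m, pairBall v c s m' m := by
  refine ⟨rawEnergy v (bumpState hs).ψ, bumpBound hs, rawEnergy_bumpState_lt_top hs v,
    ENNReal.coe_lt_top, fun n c hsep => ?_⟩
  refine (infEnergy_le (clusterState hs hsep n le_rfl)).trans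
    ((rawEnergy_clusterState_le hv hs hsep n le_rfl).trans (le_of_eq ?_))
  rw [Finset.sum_add_distrib, Finset.sum_const, Finset.card_range, nsmul_eq_mul, Finset.mul_sum]

end Cluster

end Literature.MathematicalPhysics.QuantumManyBody.BoseGas

end
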